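import Summits.ValiantsHypothesis.ValiantsHypothesis.Theorems.DepthWindowPDerivSpan
import Literature.Computability.AlgebraicComplexity.CircuitGateSemantics
import Mathlib.Data.Complex.Basic
import Mathlib.Data.List.GetD
import HarnessLib

/-!
# Route `DepthWindow`, g8 — NW96 upper bound for homogeneous blocks of relative product-depth `≤ 1`

In the gate model of `Literature/Computability/AlgebraicComplexity/ArithCircuit.lean`, a gate list
`Ψ` all of whose product-depth entries (`gateWDepths prodWeight Ψ`) are `≤ 1` and all of whose
values are homogeneous is a homogeneous `ΣΠΣ` circuit: a value of depth entry `0` is AFFINE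
(`affEval_of_depth_zero` — sums of constants, variables and earlier depth-`0` values), a product
gate multiplies affine values which, being homogeneous, are linear forms or constants, and sum
gates act linearly.  Following Nisan–Wigderson [cite: NisanWigderson1996, Thm. 1], the order-`r`
iterated partial derivatives of the degree-`2r` components of all values of `Ψ` then lie in ONE
space of dimension `≤ |Ψ| · 2^{2r}` (`product_step`, `depthOne_span`): for a product of affine
forms only the products with exactly `2r` linear factors contribute to the degree-`2r` component,
and their order-`r` derivatives lie in the span of the `≤ 2^{2r}` sub-products
(`dlist_C_mul_prod_mem_span` of `Theorems/DepthWindowPDerivSpan.lean`).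

This is the upper-bound half of the negative rung `¬ HomRel 1 1`
(`Theorems/DepthWindowHomRelOneOne.lean`) on the `HomSubReach` ladder of route `DepthWindow`.
Nothing in this file bears on `VP ≠ VNP`.

[cite: NisanWigderson1996, Thm. 1] [cite: Burgisser2000, Def. 2.1]
-/

set_option linter.dupNamespace false

namespace Summit.ValiantsHypothesis.ValiantsHypothesis.Theorems.DepthWindow

open MvPolynomial Literature.Computability.AlgebraicComplexity ArithCircuit

/-! ### Affine values: `C b + ∑ₜ mₜ • Xₜ` -/

section Affine

variable {τ : Type} [Fintype τ]

/-- The affine polynomial with constant term `b` and linear coefficients `m`. -/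
noncomputable def affEval (b : ℂ) (m : τ → ℂ) : MvPolynomial τ ℂ := C b + ∑ t, m t • X t

/-- `0` is affine. -/
theorem affEval_zero : (0 : MvPolynomial τ ℂ) = affEval 0 (0 : τ → ℂ) := by
  simp [affEval]

/-- `C c` is affine. -/
theorem C_eq_affEval (c : ℂ) : (C c : MvPolynomial τ ℂ) = affEval c (0 : τ → ℂ) := by
  simp [affEval]

/-- `X t` is affine. -/
theorem X_eq_affEval [DecidableEq τ] (t : τ) :
    (X t : MvPolynomial τ ℂ) = affEval 0 (Pi.single t (1 : ℂ)) := by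
  unfold affEval
  rw [map_zero, zero_add]
  simp_rw [Pi.single_apply, ite_smul, one_smul, zero_smul]
  rw [Finset.sum_ite_eq']; simp

/-- Affine polynomials are closed under scaling. -/
theorem smul_affEval (c b : ℂ) (m : τ → ℂ) : c • affEval b m = affEval (c * b) (c • m) := by
  unfold affEval
  rw [smul_add, Finset.smul_sum, map_mul, ← C_mul', ]
  congr 1
  exact Finset.sum_congr rfl fun t _ => by rw [Pi.smul_apply, smul_eq_mul, mul_smul]

/-- Affine polynomials are closed under addition. -/
theorem affEval_add (b b' : ℂ) (m m' : τ → ℂ) :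
    affEval b m + affEval b' m' = affEval (b + b') (m + m') := by
  unfold affEval
  rw [map_add]
  simp_rw [Pi.add_apply, add_smul, Finset.sum_add_distrib]
  abel

/-- First partials of an affine polynomial are constants. [cite: NisanWigderson1996, Thm. 1] -/
theorem pderiv_affEval [DecidableEq τ] (s : τ) (b : ℂ) (m : τ → ℂ) :
    pderiv s (affEval b m) = C (m s) := by
  unfold affEval
  rw [map_add, pderiv_C, zero_add, map_sum]
  simp_rw [Derivation.map_smul, pderiv_X, Pi.single_apply, smul_ite, smul_zero]
  rw [Finset.sum_ite_eq', if_pos (Finset.mem_univ s), smul_eq_C_mul, mul_one]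

/-- An affine polynomial has total degree `≤ 1`. -/
theorem totalDegree_affEval_le (b : ℂ) (m : τ → ℂ) : (affEval b m).totalDegree ≤ 1 := by
  unfold affEval
  refine (totalDegree_add _ _).trans (max_le (by simp) ?_)
  refine (totalDegree_finsetSum _ _).trans (Finset.sup_le fun t _ => ?_)
  exact (totalDegree_smul_le _ _).trans (by simp)

/-- The constant coefficient of an affine polynomial. -/
theorem coeff_zero_affEval (b : ℂ) (m : τ → ℂ) : coeff 0 (affEval b m) = b := by
  classical
  unfold affEval
  rw [coeff_add, coeff_C, if_pos rfl, coeff_sum, Finset.sum_eq_zero, add_zero]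
  intro t _
  rw [coeff_smul, coeff_zero_X, smul_zero]

/-- A weighted list sum of affine polynomials is affine. -/
theorem list_sum_affEval (V : List (MvPolynomial τ ℂ)) :
    ∀ args : List (ℂ × Operand ℂ τ),
      (∀ a ∈ args, ∃ (b : ℂ) (m : τ → ℂ), a.2.eval V = affEval b m) →
      ∃ (b : ℂ) (m : τ → ℂ), (args.map fun a => a.1 • a.2.eval V).sum = affEval b m
  | [], _ => ⟨0, 0, by simpa using affEval_zero⟩
  | a :: args, h => by
      obtain ⟨b, m, hb⟩ := h a (by simp)
      obtain ⟨b', m', hb'⟩ := list_sum_affEval V args fun a' ha' => h a' (by simp [ha'])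
      refine ⟨a.1 * b + b', a.1 • m + m', ?_⟩
      rw [List.map_cons, List.sum_cons, hb', hb, smul_affEval, affEval_add]

end Affine

/-! ### Depth-`0` gates have affine values -/

section DepthZero

variable {τ : Type} [Fintype τ]

/-- Every operand evaluates to an affine polynomial, provided gate references in range point at
affine values. -/
theorem operand_affEval (V : List (MvPolynomial τ ℂ)) (u : Operand ℂ τ)
    (hV : ∀ j : ℕ, u = Operand.gate j → j < V.length → ∃ (b : ℂ) (m : τ → ℂ), V.getD j 0 = affEval b m) :
    ∃ (b : ℂ) (m : τ → ℂ), u.eval V = affEval b m := by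
  classical
  cases u with
  | var t => exact ⟨0, Pi.single t 1, X_eq_affEval t⟩
  | const c => exact ⟨c, 0, C_eq_affEval c⟩
  | gate j =>
      by_cases hj : j < V.length
      · exact hV j rfl hj
      · refine ⟨0, 0, ?_⟩
        rw [Operand.eval_gate, List.getD_eq_default _ _ (by omega)]
        exact affEval_zero

/-- **Depth-`0` gates are affine.**  In any gate list, a gate whose product-depth entry is `0` is a
sum gate over depth-`0` operands, hence its value is `C b + ∑ₜ mₜ Xₜ`. [cite: Burgisser2000, Def. 2.1] -/
theorem affEval_of_depth_zero (Ψ : List (Gate ℂ τ)) :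
    ∀ j < Ψ.length, (gateWDepths prodWeight Ψ).getD j 0 = 0 →
      ∃ (b : ℂ) (m : τ → ℂ), (gateValues Ψ).getD j 0 = affEval b m := by
  induction Ψ using List.reverseRecOn with
  | nil => intro j hj; simp at hj
  | append_singleton Ψ G ih =>
      intro j hj hdj
      rw [List.length_append, List.length_singleton] at hj
      rw [gateValues_append_singleton]
      by_cases hjl : j < Ψ.length
      · rw [List.getD_append _ _ _ _ (by simpa using hjl)]
        rw [gateWDepths_append_singleton, List.getD_append _ _ _ _
          (by rw [gateWDepths_length]; exact hjl)] at hdj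
        exact ih j hjl hdj
      · obtain rfl : j = Ψ.length := by omega
        rw [List.getD_append_right _ _ _ _ (by simp), gateValues_length, Nat.sub_self,
          List.getD_cons_zero]
        rw [gateWDepths_append_singleton, List.getD_append_right _ _ _ _
          (by rw [gateWDepths_length]), gateWDepths_length, Nat.sub_self, List.getD_cons_zero] at hdj
        cases G with
        | prod args => simp [prodWeight, Gate.isProd] at hdj
        | sum args =>
            have hops : ∀ u ∈ (args.map Prod.snd),
                Operand.depthIn (gateWDepths prodWeight Ψ) u ≤ 0 := by
              intro u hu
              have h0 : ((Gate.sum args).args.map (Operand.depthIn (gateWDepths prodWeight Ψ))).foldr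
                  max 0 = 0 := by simp [prodWeight, Gate.isProd] at hdj; exact hdj
              have := le_foldr_max_of_mem (l := ((Gate.sum args).args.map
                (Operand.depthIn (gateWDepths prodWeight Ψ))))
                (List.mem_map.mpr ⟨u, hu, rfl⟩)
              omega
            show ∃ b m, ((args.map fun a => a.1 • a.2.eval (gateValues Ψ)).sum) = affEval b m
            refine list_sum_affEval (gateValues Ψ) args fun a ha => ?_
            refine operand_affEval (gateValues Ψ) a.2 fun j' hj' hlt => ?_
            rw [gateValues_length] at hlt
            refine ih j' hlt ?_
            have h := hops a.2 (List.mem_map.mpr ⟨a, ha, rfl⟩)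
            rw [hj'] at h
            simp only [Operand.depthIn] at h
            omega

end DepthZero

/-! ### The product step: derivatives of a homogeneous product of affine forms -/

section ProductStep

variable {τ : Type} [Fintype τ]

/-- An affine polynomial which is homogeneous of some degree and not a constant is homogeneous of
degree `1`. -/
theorem isHomogeneous_one_of_affEval {v : MvPolynomial τ ℂ} {b : ℂ} {m : τ → ℂ}
    (hv : v = affEval b m) {e : ℕ} (he : v.IsHomogeneous e) (hnc : ¬ ∃ c : ℂ, v = C c) :
    v.IsHomogeneous 1 := by
  have hne : v ≠ 0 := fun h => hnc ⟨0, by rw [h, map_zero]⟩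
  have hdeg : v.totalDegree = 1 := by
    have h1 : v.totalDegree ≤ 1 := hv ▸ totalDegree_affEval_le b m
    rcases Nat.lt_or_ge v.totalDegree 1 with h | h
    · exact absurd ⟨_, (totalDegree_eq_zero_iff_eq_C.mp (by omega))⟩ hnc
    · omega
  have := he.totalDegree hne
  rw [hdeg] at this
  subst this
  exact he

/-- **Product step (NW96 upper bound, one gate).**  If every factor `v j` is affine and
homogeneous of some degree, then all order-`r` iterated derivatives of the degree-`2r` component
of `∏ⱼ v j` lie in the span of at most `2^{2r}` polynomials. [cite: NisanWigderson1996, Thm. 1] -/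
theorem product_step (r : ℕ) {n : ℕ} (v : Fin n → MvPolynomial τ ℂ)
    (haff : ∀ j, ∃ (b : ℂ) (m : τ → ℂ), v j = affEval b m)
    (hhom : ∀ j, ∃ e : ℕ, (v j).IsHomogeneous e) :
    ∃ S : Finset (MvPolynomial τ ℂ), S.card ≤ 2 ^ (2 * r) ∧
      ∀ L : List τ, L.length = r →
        dlist L (homogeneousComponent (2 * r) (∏ j, v j)) ∈
          Submodule.span ℂ (S : Set (MvPolynomial τ ℂ)) := by
  classical
  -- split the factors into constants and linear forms
  set Lin : Finset (Fin n) := Finset.univ.filter fun j => ¬ ∃ c : ℂ, v j = C c with hLin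
  have hconst : ∀ j ∈ Finset.univ.filter (fun j => ∃ c : ℂ, v j = C c), v j = C (coeff 0 (v j)) := by
    intro j hj
    obtain ⟨c, hc⟩ := (Finset.mem_filter.mp hj).2
    rw [hc, coeff_C, if_pos rfl]
  have hsplit : ∏ j, v j = C (∏ j ∈ Finset.univ.filter (fun j => ∃ c : ℂ, v j = C c), coeff 0 (v j))
      * ∏ j ∈ Lin, v j := by
    rw [← Finset.prod_filter_mul_prod_filter_not Finset.univ (fun j => ∃ c : ℂ, v j = C c), map_prod]
    congr 1
    exact Finset.prod_congr rfl hconst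
  have hQ : (∏ j ∈ Lin, v j).IsHomogeneous Lin.card := by
    rw [Finset.card_eq_sum_ones]
    refine IsHomogeneous.prod Lin v (fun _ => 1) fun j hj => ?_
    obtain ⟨b, m, hb⟩ := haff j
    obtain ⟨e, he⟩ := hhom j
    exact isHomogeneous_one_of_affEval hb he (Finset.mem_filter.mp hj).2
  have hpart : ∀ j (s : τ), ∃ c : ℂ, pderiv s (v j) = C c := by
    intro j s
    obtain ⟨b, m, hb⟩ := haff j
    exact ⟨m s, by rw [hb, pderiv_affEval]⟩
  by_cases hcard : Lin.card = 2 * r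
  · refine ⟨subprods Lin v r, (card_subprods_le Lin v r).trans (by rw [hcard]), fun L hL => ?_⟩
    rw [hsplit, homogeneousComponent_C_mul, homogeneousComponent_of_mem hQ, if_pos hcard.symm, ← hL]
    exact dlist_C_mul_prod_mem_span Lin v hpart _ L
  · refine ⟨∅, by simp, fun L _ => ?_⟩
    rw [hsplit, homogeneousComponent_C_mul, homogeneousComponent_of_mem hQ,
      if_neg (fun h => hcard h.symm), mul_zero, dlist_zero]
    exact Submodule.zero_mem _

end ProductStep

/-! ### The invariant over a homogeneous block of relative product-depth `≤ 1` -/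

section Block

variable {τ : Type} [Fintype τ]

omit [Fintype τ] in
/-- Components of degree `2r ≥ 2` of an operand value: zero for variables and constants, the
component of a listed value for an in-range gate reference, zero out of range. -/
theorem dlist_hc_operand_mem (r : ℕ) (hr : 1 ≤ r) (V : List (MvPolynomial τ ℂ))
    (B : Finset (MvPolynomial τ ℂ))
    (hV : ∀ g ∈ V, ∀ L : List τ, L.length = r →
      dlist L (homogeneousComponent (2 * r) g) ∈ Submodule.span ℂ (B : Set (MvPolynomial τ ℂ)))
    (u : Operand ℂ τ) (L : List τ) (hL : L.length = r) :
    dlist L (homogeneousComponent (2 * r) (u.eval V)) ∈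
      Submodule.span ℂ (B : Set (MvPolynomial τ ℂ)) := by
  cases u with
  | var t =>
      rw [show (Operand.var t : Operand ℂ τ).eval V = X t from rfl,
        homogeneousComponent_of_mem (isHomogeneous_X ℂ t), if_neg (by omega), dlist_zero]
      exact Submodule.zero_mem _
  | const c =>
      rw [show (Operand.const c : Operand ℂ τ).eval V = C c from rfl,
        homogeneousComponent_of_mem (isHomogeneous_C τ c), if_neg (by omega), dlist_zero]
      exact Submodule.zero_mem _
  | gate j =>
      rw [Operand.eval_gate]
      by_cases hj : j < V.length
      · rw [List.getD_eq_getElem _ _ hj]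
        exact hV _ (List.getElem_mem hj) L hL
      · rw [List.getD_eq_default _ _ (by omega), map_zero, dlist_zero]
        exact Submodule.zero_mem _

omit [Fintype τ] in
/-- Sum gates: linearity. -/
theorem dlist_hc_sum_mem (r : ℕ) (hr : 1 ≤ r) (V : List (MvPolynomial τ ℂ))
    (B : Finset (MvPolynomial τ ℂ))
    (hV : ∀ g ∈ V, ∀ L : List τ, L.length = r →
      dlist L (homogeneousComponent (2 * r) g) ∈ Submodule.span ℂ (B : Set (MvPolynomial τ ℂ)))
    (L : List τ) (hL : L.length = r) :
    ∀ args : List (ℂ × Operand ℂ τ),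
      dlist L (homogeneousComponent (2 * r) ((args.map fun a => a.1 • a.2.eval V).sum)) ∈
        Submodule.span ℂ (B : Set (MvPolynomial τ ℂ))
  | [] => by simp
  | a :: args => by
      rw [List.map_cons, List.sum_cons, map_add, dlist_add, map_smul, dlist_smul]
      exact Submodule.add_mem _ (Submodule.smul_mem _ _ (dlist_hc_operand_mem r hr V B hV a.2 L hL))
        (dlist_hc_sum_mem r hr V B hV L hL args)

/-- **NW96 upper bound for homogeneous blocks of relative product-depth `≤ 1`.**  If every depth
entry of `Ψ` is `≤ 1` and every gate value is homogeneous, then there is a finset `B` of at most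
`|Ψ| · 4^r` polynomials whose span contains every order-`r` iterated partial derivative (along any
list of `r` variables) of the degree-`2r` component of every gate value (`r ≥ 1`).
[cite: NisanWigderson1996, Thm. 1] -/
theorem depthOne_span (r : ℕ) (hr : 1 ≤ r) :
    ∀ Ψ : List (Gate ℂ τ), (∀ n ∈ gateWDepths prodWeight Ψ, n ≤ 1) →
      (∀ g ∈ gateValues Ψ, ∃ e : ℕ, g.IsHomogeneous e) →
      ∃ B : Finset (MvPolynomial τ ℂ), B.card ≤ Ψ.length * 2 ^ (2 * r) ∧
        ∀ g ∈ gateValues Ψ, ∀ L : List τ, L.length = r →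
          dlist L (homogeneousComponent (2 * r) g) ∈ Submodule.span ℂ (B : Set (MvPolynomial τ ℂ)) := by
  classical
  intro Ψ
  induction Ψ using List.reverseRecOn with
  | nil => intro _ _; exact ⟨∅, by simp, fun g hg => by simp [gateValues] at hg⟩
  | append_singleton Ψ G ih =>
      intro hdep hhom
      rw [gateWDepths_append_singleton] at hdep
      rw [gateValues_append_singleton] at hhom
      obtain ⟨B, hB, hmem⟩ := ih (fun n hn => hdep n (List.mem_append_left _ hn))
        (fun g hg => hhom g (List.mem_append_left _ hg))
      have hnew := hdep _ (List.mem_append_right _ (List.mem_singleton_self _))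
      rw [gateValues_append_singleton, List.length_append, List.length_singleton]
      cases G with
      | sum args =>
          refine ⟨B, hB.trans (Nat.mul_le_mul_right _ (Nat.le_succ _)), fun g hg L hL => ?_⟩
          rw [List.mem_append, List.mem_singleton] at hg
          rcases hg with hg | rfl
          · exact hmem g hg L hL
          · exact dlist_hc_sum_mem r hr _ B hmem L hL args
      | prod args =>
          -- every operand of the product gate is affine and homogeneous
          have hops0 : ∀ u ∈ args, Operand.depthIn (gateWDepths prodWeight Ψ) u ≤ 0 := by
            intro u hu
            have h1 : prodWeight (Gate.prod args : Gate ℂ τ) = 1 := by simp [prodWeight, Gate.isProd]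
            rw [h1] at hnew
            have := le_foldr_max_of_mem (l := ((Gate.prod args : Gate ℂ τ).args.map
              (Operand.depthIn (gateWDepths prodWeight Ψ)))) (List.mem_map.mpr ⟨u, hu, rfl⟩)
            omega
          set v : Fin args.length → MvPolynomial τ ℂ := fun j => (args[j]).eval (gateValues Ψ) with hv
          have haff : ∀ j, ∃ (b : ℂ) (m : τ → ℂ), v j = affEval b m := by
            intro j
            refine operand_affEval (gateValues Ψ) args[j] fun j' hj' hlt => ?_
            rw [gateValues_length] at hlt
            refine affEval_of_depth_zero Ψ j' hlt ?_
            have h := hops0 args[j] (List.getElem_mem j.2)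
            rw [hj'] at h
            simp only [Operand.depthIn] at h
            omega
          have hhomv : ∀ j, ∃ e : ℕ, (v j).IsHomogeneous e := by
            intro j
            show ∃ e : ℕ, ((args[j]).eval (gateValues Ψ)).IsHomogeneous e
            cases args[j] with
            | var t => exact ⟨1, isHomogeneous_X ℂ t⟩
            | const c => exact ⟨0, isHomogeneous_C τ c⟩
            | gate j' =>
                rw [Operand.eval_gate]
                by_cases hj' : j' < (gateValues Ψ).length
                · rw [List.getD_eq_getElem _ _ hj']
                  exact hhom _ (List.mem_append_left _ (List.getElem_mem hj'))
                · rw [List.getD_eq_default _ _ (by omega)]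
                  exact ⟨0, isHomogeneous_zero τ ℂ 0⟩
          obtain ⟨S, hS, hSmem⟩ := product_step r v haff hhomv
          have hval : (Gate.prod args).eval (gateValues Ψ) = ∏ j, v j := by
            rw [show (Gate.prod args).eval (gateValues Ψ) =
              (args.map fun u => u.eval (gateValues Ψ)).prod from rfl,
              ← List.ofFn_getElem_eq_map, List.prod_ofFn]
            rfl
          refine ⟨B ∪ S, ?_, fun g hg L hL => ?_⟩
          · exact (Finset.card_union_le _ _).trans (by rw [Nat.add_mul, Nat.one_mul]; omega)
          · rw [List.mem_append, List.mem_singleton] at hg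
            rw [Finset.coe_union]
            rcases hg with hg | rfl
            · exact Submodule.span_mono Set.subset_union_left (hmem g hg L hL)
            · rw [hval]
              exact Submodule.span_mono Set.subset_union_right (hSmem L hL)

end Block

end Summit.ValiantsHypothesis.ValiantsHypothesis.Theorems.DepthWindow
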